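import Summits.CriticalPhenomena.SAWScalingLimit.Theses.SAWStochasticQuantisation
import Summits.CriticalPhenomena.SAWScalingLimit.Theorems.SubseqIdentification.Negative.ProbabilityRedundant

/-!
# Crux `DiffusiveSteinLimit` (stmt-CriticalPhenomena-7764) — birth skeleton `Lines/birth.lean`

Route `SAWStochasticQuantisation` (rank-2 crux; `ledger crux ls stmt-CriticalPhenomena-7764`: no earlier
workfiles, no `Disproof.lean`).  Crux, BY NAME:
`Summit.CriticalPhenomena.SAWScalingLimit.Theses.SAWStochasticQuantisation.DiffusiveSteinLimit` — for every
Dobrushin domain `D` and endpoint approximation `(a_δ, b_δ)` there is a STEIN PAIR `(𝒞, L)` (bounded continuous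
functionals on `CurveClass ℂ`, `L : 𝒞 → C_b`) with (i) `(F, LF)` the graph limit, along uniformly `o(1)`
lattice correctors and in `L¹(P_δ)`, of the `δ^{-8/3}`-sped-up Metropolis–BFACF generators of the critical SAW
laws `P_δ`; (ii) `𝒞` an algebra stable under `C²` functional calculus, `L` linear with the second-order
chain rule; (iii) STEIN UNIQUENESS: two chord probability laws of `(D; a, b)` annihilated by `L(𝒞)` coincide.

## The line `birth` — intrinsic clock + Stein duality + separating class

Two classical reductions and one exponent law cut the crux into three named pieces, none of which is
the crux or the summit in other words (BC3 probes below), and whose composition is a genuine proof: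

* **(C) `stub_intrinsicSteinCore`** (HARDEST, open; the dynamical content).  The crux's pair, but
  (1) clocked INTRINSICALLY — the generators are sped up by `δ^{-4}/⟨N⟩_δ`, `⟨N⟩_δ = E_{P_δ}|γ|` the mean
  length of the critical SAW, instead of the numerically predicted `δ^{-8/3}` (each BFACF move changes the
  signed area by `±δ²` and there are `≍ |γ|` available moves, so `δ^{-4}/⟨N⟩_δ` is the speed at which the
  carré du champ of the area is `Θ(1)`: MadrasSlade1993 §9.6.1 and (9.6.11), `τ ≳ ⟨N⟩²` sweeps;
  Caracciolo–Pelissetto–Sokal doi:10.1007/bf01029987) — so that (C) no longer "rests on numerics"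
  (the crux's first listed failure mode is isolated in (N)); and (2) with Stein uniqueness (iii) replaced
  by its CONSTRUCTIVE DUAL: `𝒞` separates the chords of `D̄` from `a` to `b`, and the Stein/Poisson equation
  `L F = H − c` is solvable in `𝒞` up to `ε` in `L¹(ρ)` for every target `H ∈ 𝒞` and every finite measure
  `ρ` carried by chords (Stein's method: an operator characterises its law iff its Stein equation is
  solvable on a determining class; EthierKurtz1986 Ch. 4 §9; for the intended ergodic diffusion,
  `F = −∫₀ᵀ P_t H dt` solves it up to `‖P_T H − ⟨H⟩‖_{L¹(ρ)}`, i.e. pointwise convergence to equilibrium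
  from `ρ`-a.e. chord).  Only ANNIHILATED `ρ` (namely `ρ = μ + ν`) are used below, and for those the
  solvability clause is implied by (iii) itself (Hahn–Banach: a bounded `g ⟂ ℝ + L𝒞` in `L¹(Q)` would make
  `(1 + tg)Q` a second annihilated chord law), so (C) is the crux ∧ (separation) up to the clock.
  Size XL (open problem: corrector/homogenisation bounds for the renormalised curvature drift, carré du
  champ law of large numbers, ergodicity of the limit).
* **(N) `stub_meanLengthScaling`** (open; a STATIC exponent law, `ν = 3/4` in a domain with a limit).
  `δ^{4/3} · E_{P_δ}|γ| → ℓ(D, a, b) ∈ (0, ∞)` along every endpoint approximation: the mean number of steps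
  of the critical SAW crossing a Dobrushin domain is `≍ δ^{-4/3}` (LawlerSchrammWerner2004SAW §3–4: `N`
  of order `δ^{-4/3}`, SLE_{8/3} has dimension `4/3`; natural parametrisation of SLE_{8/3}).  Both bounds
  are open (sub-ballisticity, Duminil-Copin–Hammond 2013, gives only `N ≫ δ^{-1}`); not in the negatives
  index.  It converts the intrinsic clock into `δ^{-8/3}`: `δ^{-8/3} = (δ^{4/3}⟨N⟩_δ) · (δ^{-4}/⟨N⟩_δ)`.
  Size L–XL.
* **(S) `stub_separatingAlgebra`** (provable now; pure measure theory on the curve space).  A class of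
  bounded continuous functionals on `CurveClass ℂ` closed under products and separating the chords of
  `(D; a, b)` DETERMINES chord probability laws (Ethier–Kurtz Ch. 3 Thm 4.5(a) on the closed chord set of
  the Polish space `CurveClass ℂ` — `CurveClass.instPolishSpace`; proof: Lindelöf ⇒ a countable separating
  subfamily, Lusin–Souslin `Continuous.measurableEmbedding` ⇒ it generates the Borel σ-algebra of the
  chord set, moments of `(F₁,…,F_k)_*μ` on a compact box + Weierstrass ⇒ equality on the generating
  π-system).  Size M–L.

`DiffusiveSteinLimit_of (hC) (hN) (hS) : DiffusiveSteinLimit` is PROVED below (no `sorry` of its own):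
take the core `𝒞` of (C) and `L := ℓ • L₁`; (i) at speed `δ^{-8/3}` is the change of clock
`tendsto_rescale` (the laws are eventually probability measures on finite sets —
`eventually_isProbabilityMeasure_law`, `finite_domainSAW` — so every lattice functional is integrable and
`∫|δ^{-8/3}X − ℓG| ≤ |r_δ| ∫|s_δ X − G| + |r_δ − ℓ|·sup|G|`, `r_δ = δ^{4/3}⟨N⟩_δ → ℓ`); (ii) is homogeneous
in `L`; (iii) for `L₁` is the Stein step `integral_eq_of_steinSolvable` (solvability at `ρ = μ + ν` gives
`|∫H dμ − ∫H dν| ≤ ε` for `H ∈ 𝒞`) followed by (S), and annihilation by `ℓ • L₁` is annihilation by `L₁`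
(`ℓ ≠ 0`).  Hypotheses = the three stubs under their registered names (`Registered.stub_…`, the
skeleton-check convention of `Cruxes/LimitExists/Lines/birth.lean`); conclusion = the route decl BY NAME.

Sorries: exactly 3 = the three `stub_*`; zero elsewhere (`lean check`: rc 0, sorries 3, errors none).
Disproof used: none exists for this crux.  Negatives honoured: none of the 11 refuted statements of the
summit (`ledger negatives --problem CriticalPhenomena`, 2026-08-17) concerns generator limits, Stein
cores, mean-length scaling or determining classes; the refuted all-`δ` tightness stmt-0772 is not used.
BC3 probes (planner folder `bc/stub_*_probe*.lean`, each importing only the route file): for each stub,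
`stub → DiffusiveSteinLimit` and `stub → SAWScalingLimit` by `first | exact? | simpa | simpa [Stub] |
(unfold Stub; simpa) | aesop` FAIL (6/6; for (C) also tactic-by-tactic: `exact?` heartbeat-out /
"could not close the goal", `simpa` "assumption failed", `aesop` "failed after exhaustive search").
-/

noncomputable section

open MeasureTheory Filter Topology Set Function
open Literature.Probability.RandomPlanarGeometry Literature.Probability.LatticeModels
open scoped ENNReal NNReal Topology Classical

namespace Summit.CriticalPhenomena.SAWScalingLimit.Cruxes.DiffusiveSteinLimit.Birth

open Summit.CriticalPhenomena.SAWScalingLimit.Theorems.SubseqIdentification.Negative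
  (eventually_isProbabilityMeasure_law)

/-! ## The registered stubs (the ONLY `sorry`s of this file) -/

/-- **stub (C) — AN INTRINSICALLY-CLOCKED, SOLVABLE, SEPARATING STEIN CORE** (hardest; open).
For every Dobrushin domain and endpoint approximation there are a set `𝒞` of bounded continuous
functionals on `CurveClass ℂ` and `L : 𝒞 → C_b` such that: (i') every `F ∈ 𝒞` has lattice correctors
`f_δ` with `sup|f_δ − F∘curve| → 0` and `∫ |(δ^{-4}/⟨N⟩_δ)·(L_δ f_δ) − (LF)∘curve| dP_δ → 0`, where
`L_δ` is the Metropolis–BFACF generator at `x_c` (inlined exactly as in the route file) and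
`⟨N⟩_δ = ∫ |γ| dP_δ` the mean length — the INTRINSIC diffusive clock; (ii) `𝒞` is an algebra stable
under `C²` functional calculus and `L` is linear with the second-order chain rule (verbatim the crux);
(sep) `𝒞` separates the chords of `D̄` from `a` to `b`; (solv) for every finite measure `ρ` carried by
those chords, every `H ∈ 𝒞` and `ε > 0` there are `F ∈ 𝒞`, `c ∈ ℝ` with `∫ |H − c − LF| dρ ≤ ε`
(approximate solvability of the Stein/Poisson equation in the core).  Why plausibly true: it is the
crux's own conjectural object (the generator of diffusively rescaled critical BFACF on SLE_{8/3}
chords) read at its own clock, with uniqueness of the invariant law in the constructive form that an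
ergodic diffusion supplies (`F = −∫₀ᵀ P_t H dt`).  Why it might fail: as the crux (correctors may not
absorb the `δ^{-4/3}` pointwise drift; a conserved slow mode), plus: solvability in `L¹(ρ)` for
NON-annihilated wild `ρ` is more than uniqueness needs (only `ρ = μ + ν` annihilated is used).
[cite: MadrasSlade1993, §9.6.1 and (9.6.11)] [cite: EthierKurtz1986, Ch. 4 §9]
[cite: KipnisVaradhan1986] -/
theorem stub_intrinsicSteinCore :
    let gen : ∀ (Ω : Set ℂ) (δ : ℝ) (u v : Literature.Probability.LatticeModels.Site 2), (Literature.Probability.RandomPlanarGeometry.SAW.DomainSAW Ω δ u v → ℝ) → Literature.Probability.RandomPlanarGeometry.SAW.DomainSAW Ω δ u v → ℝ := fun Ω δ u v g γ => ∑ᶠ γ' : Literature.Probability.RandomPlanarGeometry.SAW.DomainSAW Ω δ u v, (if (∃ (p q s s' : List (Literature.Probability.LatticeModels.Site 2)) (y z : Literature.Probability.LatticeModels.Site 2), γ.walk.support = p ++ y :: (s ++ z :: q) ∧ γ'.walk.support = p ++ y :: (s' ++ z :: q) ∧ s ≠ s' ∧ s.length + s'.length = 2) then min 1 (Literature.Probability.RandomPlanarGeometry.SAW.criticalFugacity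 ^ ((γ'.length : ℤ) - (γ.length : ℤ))) * (g γ' - g γ) else 0)
    let mem : ∀ (D : Literature.Probability.RandomPlanarGeometry.DobrushinDomain) (a b : ℝ → Literature.Probability.LatticeModels.Site 2), (Literature.Probability.RandomPlanarGeometry.CurveClass ℂ → ℝ) → (Literature.Probability.RandomPlanarGeometry.CurveClass ℂ → ℝ) → Prop := fun D a b F G => ∃ f : ∀ δ : ℝ, Literature.Probability.RandomPlanarGeometry.SAW.DomainSAW D.carrier δ (a δ) (b δ) → ℝ, (∀ ε : ℝ, 0 < ε → ∀ᶠ δ in 𝓝[>] (0 : ℝ), ∀ γ : Literature.Probability.RandomPlanarGeometry.SAW.DomainSAW D.carrier δ (a δ) (b δ), |f δ γ - F γ.curve| ≤ ε) ∧ Filter.Tendsto (fun δ : ℝ => ∫ γ, |(δ ^ (-(4 : ℝ)) / ∫ γ', (γ'.length : ℝ) ∂(Literature.Probability.RandomPlanarGeometry.SAW.law D.carrier δ (a δ) (b δ))) * gen D.carrier δ (a δ) (b δ) (f δ) γ - G γ.curve| ∂(Literature.Probability.RandomPlanarGeometry.SAW.law D.carrier δ (a δ) (b δ))) (𝓝[>]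 (0 : ℝ)) (𝓝 0)
    ∀ (D : Literature.Probability.RandomPlanarGeometry.DobrushinDomain) (a b : ℝ → Literature.Probability.LatticeModels.Site 2), Literature.Probability.RandomPlanarGeometry.SAW.IsEndpointApprox D a b → ∃ (𝒞 : Set (Literature.Probability.RandomPlanarGeometry.CurveClass ℂ → ℝ)) (L : (Literature.Probability.RandomPlanarGeometry.CurveClass ℂ → ℝ) → (Literature.Probability.RandomPlanarGeometry.CurveClass ℂ → ℝ)), (∀ F ∈ 𝒞, Continuous F ∧ Continuous (L F) ∧ ∃ C : ℝ, ∀ x, |F x| ≤ C ∧ |L F x| ≤ C) ∧ (∀ F ∈ 𝒞, mem D a b F (L F)) ∧ (∀ F ∈ 𝒞, ∀ G ∈ 𝒞, ∀ c : ℝ, (F + G) ∈ 𝒞 ∧ (F * G) ∈ 𝒞 ∧ (c • F) ∈ 𝒞 ∧ L (F + G) = L F + L G ∧ L (c • F) = c • L F) ∧ (∀ F ∈ 𝒞, ∀ Φ : ℝ → ℝ, ContDiff ℝ 2 Φ → (Φ ∘ F) ∈ 𝒞 ∧ ∀ x, L (Φ ∘ F) x = deriv Φ (F x) * L F x + (deriv^[2]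 Φ (F x) / 2) * (L ((fun t : ℝ => t ^ 2) ∘ F) x - 2 * F x * L F x)) ∧ (∀ γ γ' : Literature.Probability.RandomPlanarGeometry.CurveClass ℂ, (γ.source = D.pt 0 ∧ γ.target = D.pt 1 ∧ γ.range ⊆ closure D.carrier) → (γ'.source = D.pt 0 ∧ γ'.target = D.pt 1 ∧ γ'.range ⊆ closure D.carrier) → γ ≠ γ' → ∃ F ∈ 𝒞, F γ ≠ F γ') ∧ (∀ ρ : MeasureTheory.Measure (Literature.Probability.RandomPlanarGeometry.CurveClass ℂ), MeasureTheory.IsFiniteMeasure ρ → (∀ᵐ γ ∂ρ, γ.source = D.pt 0 ∧ γ.target = D.pt 1 ∧ γ.range ⊆ closure D.carrier) → ∀ H ∈ 𝒞, ∀ ε : ℝ, 0 < ε → ∃ F ∈ 𝒞, ∃ c : ℝ, ∫ γ, |H γ - c - L F γ| ∂ρ ≤ ε) := by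
  sorry

/-- **stub (N) — THE MEAN LENGTH OF THE CRITICAL SAW IN A DOBRUSHIN DOMAIN SCALES AS `δ^{-4/3}`**
(open; static).  For every Dobrushin domain and endpoint approximation there is `ℓ ∈ (0, ∞)` with
`δ^{4/3} · ∫ |γ| dP_δ → ℓ` as `δ → 0⁺` (`ν = 3/4` in a domain, with convergence of the constant: the
mean of the `4/3`-dimensional natural length).  Junk-safe: only the germ at `0⁺` matters, where `P_δ`
is a probability measure on a finite set.  Both the upper and the lower bound are open
(Duminil-Copin–Hammond sub-ballisticity gives `⟨N⟩_δ ≫ δ^{-1}` only).  It is the factor converting the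
intrinsic clock of (C) into the crux's `δ^{-8/3}`.
[cite: LawlerSchrammWerner2004SAW, §3.1–3.4 and §4.1] [cite: MadrasSlade1993, (9.6.11)]
[cite: DuminilCopinHammond2013] -/
theorem stub_meanLengthScaling :
    ∀ (D : Literature.Probability.RandomPlanarGeometry.DobrushinDomain) (a b : ℝ → Literature.Probability.LatticeModels.Site 2), Literature.Probability.RandomPlanarGeometry.SAW.IsEndpointApprox D a b → ∃ ℓ : ℝ, 0 < ℓ ∧ Filter.Tendsto (fun δ : ℝ => δ ^ ((4 : ℝ) / 3) * ∫ γ, (γ.length : ℝ) ∂(Literature.Probability.RandomPlanarGeometry.SAW.law D.carrier δ (a δ) (b δ))) (𝓝[>] (0 : ℝ)) (𝓝 ℓ) := by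
  sorry

/-- **stub (S) — POINT-SEPARATING MULTIPLICATIVE CLASSES DETERMINE CHORD LAWS** (provable now).
For a Dobrushin domain `D` and any set `𝒞` of bounded continuous functionals on `CurveClass ℂ` closed
under products and separating the chords of `D̄` from `a` to `b`, two probability measures carried by
those chords with `∫ F dμ = ∫ F dν` for all `F ∈ 𝒞` are equal — Ethier–Kurtz Ch. 3 Thm 4.5(a) on the
closed chord set of the Polish space `CurveClass ℂ` (`CurveClass.instPolishSpace`): a countable
separating subfamily exists (Lindelöf), it generates the Borel σ-algebra of the chord set
(Lusin–Souslin, `Continuous.measurableEmbedding`), and the laws of `(F₁,…,F_k)` agree by moments on a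
compact box (closure under products + Weierstrass), whence equality on a generating π-system.
[cite: EthierKurtz1986, Ch. 3 Thm 4.5(a)] [cite: BillingsleyCPM1999, Thm 1.2] -/
theorem stub_separatingAlgebra :
    ∀ (D : Literature.Probability.RandomPlanarGeometry.DobrushinDomain) (𝒞 : Set (Literature.Probability.RandomPlanarGeometry.CurveClass ℂ → ℝ)), (∀ F ∈ 𝒞, Continuous F ∧ ∃ C : ℝ, ∀ x, |F x| ≤ C) → (∀ F ∈ 𝒞, ∀ G ∈ 𝒞, (F * G) ∈ 𝒞) → (∀ γ γ' : Literature.Probability.RandomPlanarGeometry.CurveClass ℂ, (γ.source = D.pt 0 ∧ γ.target = D.pt 1 ∧ γ.range ⊆ closure D.carrier) → (γ'.source = D.pt 0 ∧ γ'.target = D.pt 1 ∧ γ'.range ⊆ closure D.carrier) → γ ≠ γ' → ∃ F ∈ 𝒞, F γ ≠ F γ') → ∀ μ ν : MeasureTheory.Measure (Literature.Probability.RandomPlanarGeometry.CurveClass ℂ), MeasureTheory.IsProbabilityMeasure μ → MeasureTheory.IsProbabilityMeasure ν → (∀ᵐ γ ∂μ, γ.source = D.pt 0 ∧ γ.target =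 D.pt 1 ∧ γ.range ⊆ closure D.carrier) → (∀ᵐ γ ∂ν, γ.source = D.pt 0 ∧ γ.target = D.pt 1 ∧ γ.range ⊆ closure D.carrier) → (∀ F ∈ 𝒞, ∫ x, F x ∂μ = ∫ x, F x ∂ν) → μ = ν := by
  sorry

/-! ## Name-keyed aliases of the stub statements (skeleton-check convention) -/

namespace Registered

/-- Alias keyed by the stub name: the statement of `stub_intrinsicSteinCore`. -/
abbrev stub_intrinsicSteinCore : Prop :=
    let gen : ∀ (Ω : Set ℂ) (δ : ℝ) (u v : Literature.Probability.LatticeModels.Site 2), (Literature.Probability.RandomPlanarGeometry.SAW.DomainSAW Ω δ u v → ℝ) → Literature.Probability.RandomPlanarGeometry.SAW.DomainSAW Ω δ u v → ℝ := fun Ω δ u v g γ => ∑ᶠ γ' : Literature.Probability.RandomPlanarGeometry.SAW.DomainSAW Ω δ u v, (if (∃ (p q s s' : List (Literature.Probability.LatticeModels.Site 2)) (y z : Literature.Probability.LatticeModels.Site 2), γ.walk.support = p ++ y :: (s ++ z :: q) ∧ γ'.walk.support = p ++ y :: (s' ++ z :: q) ∧ s ≠ s' ∧ s.length + s'.length =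 2) then min 1 (Literature.Probability.RandomPlanarGeometry.SAW.criticalFugacity ^ ((γ'.length : ℤ) - (γ.length : ℤ))) * (g γ' - g γ) else 0)
    let mem : ∀ (D : Literature.Probability.RandomPlanarGeometry.DobrushinDomain) (a b : ℝ → Literature.Probability.LatticeModels.Site 2), (Literature.Probability.RandomPlanarGeometry.CurveClass ℂ → ℝ) → (Literature.Probability.RandomPlanarGeometry.CurveClass ℂ → ℝ) → Prop := fun D a b F G => ∃ f : ∀ δ : ℝ, Literature.Probability.RandomPlanarGeometry.SAW.DomainSAW D.carrier δ (a δ) (b δ) → ℝ, (∀ ε : ℝ, 0 < ε → ∀ᶠ δ in 𝓝[>] (0 : ℝ), ∀ γ : Literature.Probability.RandomPlanarGeometry.SAW.DomainSAW D.carrier δ (a δ) (b δ), |f δ γ - F γ.curve| ≤ ε) ∧ Filter.Tendsto (fun δ : ℝ => ∫ γ, |(δ ^ (-(4 : ℝ)) / ∫ γ', (γ'.length : ℝ) ∂(Literature.Probability.RandomPlanarGeometry.SAW.law D.carrier δ (a δ) (b δ))) * gen D.carrier δ (a δ) (b δ) (f δ) γ - G γ.curve| ∂(Literature.Probability.RandomPlanarGeometry.SAW.law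 D.carrier δ (a δ) (b δ))) (𝓝[>] (0 : ℝ)) (𝓝 0)
    ∀ (D : Literature.Probability.RandomPlanarGeometry.DobrushinDomain) (a b : ℝ → Literature.Probability.LatticeModels.Site 2), Literature.Probability.RandomPlanarGeometry.SAW.IsEndpointApprox D a b → ∃ (𝒞 : Set (Literature.Probability.RandomPlanarGeometry.CurveClass ℂ → ℝ)) (L : (Literature.Probability.RandomPlanarGeometry.CurveClass ℂ → ℝ) → (Literature.Probability.RandomPlanarGeometry.CurveClass ℂ → ℝ)), (∀ F ∈ 𝒞, Continuous F ∧ Continuous (L F) ∧ ∃ C : ℝ, ∀ x, |F x| ≤ C ∧ |L F x| ≤ C) ∧ (∀ F ∈ 𝒞, mem D a b F (L F)) ∧ (∀ F ∈ 𝒞, ∀ G ∈ 𝒞, ∀ c : ℝ, (F + G) ∈ 𝒞 ∧ (F * G) ∈ 𝒞 ∧ (c • F) ∈ 𝒞 ∧ L (F + G) = L F + L G ∧ L (c • F) = c • L F) ∧ (∀ F ∈ 𝒞, ∀ Φ : ℝ → ℝ, ContDiff ℝ 2 Φ → (Φ ∘ F) ∈ 𝒞 ∧ ∀ x, L (Φ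 ∘ F) x = deriv Φ (F x) * L F x + (deriv^[2] Φ (F x) / 2) * (L ((fun t : ℝ => t ^ 2) ∘ F) x - 2 * F x * L F x)) ∧ (∀ γ γ' : Literature.Probability.RandomPlanarGeometry.CurveClass ℂ, (γ.source = D.pt 0 ∧ γ.target = D.pt 1 ∧ γ.range ⊆ closure D.carrier) → (γ'.source = D.pt 0 ∧ γ'.target = D.pt 1 ∧ γ'.range ⊆ closure D.carrier) → γ ≠ γ' → ∃ F ∈ 𝒞, F γ ≠ F γ') ∧ (∀ ρ : MeasureTheory.Measure (Literature.Probability.RandomPlanarGeometry.CurveClass ℂ), MeasureTheory.IsFiniteMeasure ρ → (∀ᵐ γ ∂ρ, γ.source = D.pt 0 ∧ γ.target = D.pt 1 ∧ γ.range ⊆ closure D.carrier) → ∀ H ∈ 𝒞, ∀ ε : ℝ, 0 < ε → ∃ F ∈ 𝒞, ∃ c : ℝ, ∫ γ, |H γ - c - L F γ| ∂ρ ≤ ε)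

/-- Alias keyed by the stub name: the statement of `stub_meanLengthScaling`. -/
abbrev stub_meanLengthScaling : Prop :=
    ∀ (D : Literature.Probability.RandomPlanarGeometry.DobrushinDomain) (a b : ℝ → Literature.Probability.LatticeModels.Site 2), Literature.Probability.RandomPlanarGeometry.SAW.IsEndpointApprox D a b → ∃ ℓ : ℝ, 0 < ℓ ∧ Filter.Tendsto (fun δ : ℝ => δ ^ ((4 : ℝ) / 3) * ∫ γ, (γ.length : ℝ) ∂(Literature.Probability.RandomPlanarGeometry.SAW.law D.carrier δ (a δ) (b δ))) (𝓝[>] (0 : ℝ)) (𝓝 ℓ)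

/-- Alias keyed by the stub name: the statement of `stub_separatingAlgebra`. -/
abbrev stub_separatingAlgebra : Prop :=
    ∀ (D : Literature.Probability.RandomPlanarGeometry.DobrushinDomain) (𝒞 : Set (Literature.Probability.RandomPlanarGeometry.CurveClass ℂ → ℝ)), (∀ F ∈ 𝒞, Continuous F ∧ ∃ C : ℝ, ∀ x, |F x| ≤ C) → (∀ F ∈ 𝒞, ∀ G ∈ 𝒞, (F * G) ∈ 𝒞) → (∀ γ γ' : Literature.Probability.RandomPlanarGeometry.CurveClass ℂ, (γ.source = D.pt 0 ∧ γ.target = D.pt 1 ∧ γ.range ⊆ closure D.carrier) → (γ'.source = D.pt 0 ∧ γ'.target = D.pt 1 ∧ γ'.range ⊆ closure D.carrier) → γ ≠ γ' → ∃ F ∈ 𝒞, F γ ≠ F γ') → ∀ μ ν : MeasureTheory.Measure (Literature.Probability.RandomPlanarGeometry.CurveClass ℂ), MeasureTheory.IsProbabilityMeasure μ → MeasureTheory.IsProbabilityMeasure ν → (∀ᵐ γ ∂μ, γ.source = D.pt 0 ∧ γ.target = D.pt 1 ∧ γ.range ⊆ closure D.carrier) → (∀ᵐ γ ∂ν, γ.source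 = D.pt 0 ∧ γ.target = D.pt 1 ∧ γ.range ⊆ closure D.carrier) → (∀ F ∈ 𝒞, ∫ x, F x ∂μ = ∫ x, F x ∂ν) → μ = ν

end Registered

/-! ## Proved glue 1: the Stein step (solvability of the Stein equation ⇒ equal integrals) -/

/-- **Stein's lemma, the direction used here.**  If for every finite measure `ρ` carried by `K`
the Stein/Poisson equation `L F = H − c` is solvable in `𝒞` up to `ε` in `L¹(ρ)`, then two
probability laws carried by `K` and annihilated by every `L F`, `F ∈ 𝒞`, give `H` the same
integral (apply solvability to `ρ = μ + ν`). [cite: EthierKurtz1986, Ch. 4 §9 (Echeverría's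
theorem and stationary distributions)] -/
theorem integral_eq_of_steinSolvable {X : Type*} [MeasurableSpace X] [TopologicalSpace X]
    [OpensMeasurableSpace X] {K : X → Prop}
    {𝒞 : Set (X → ℝ)} {L : (X → ℝ) → (X → ℝ)}
    (hbdd : ∀ F ∈ 𝒞, Continuous F ∧ Continuous (L F) ∧ ∃ C : ℝ, ∀ x, |F x| ≤ C ∧ |L F x| ≤ C)
    (hsolv : ∀ ρ : Measure X, IsFiniteMeasure ρ → (∀ᵐ x ∂ρ, K x) →
      ∀ H ∈ 𝒞, ∀ ε : ℝ, 0 < ε → ∃ F ∈ 𝒞, ∃ c : ℝ, ∫ x, |H x - c - L F x| ∂ρ ≤ ε)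
    (μ ν : Measure X) [IsProbabilityMeasure μ] [IsProbabilityMeasure ν]
    (hμK : ∀ᵐ x ∂μ, K x) (hνK : ∀ᵐ x ∂ν, K x)
    (hμL : ∀ F ∈ 𝒞, ∫ x, L F x ∂μ = 0) (hνL : ∀ F ∈ 𝒞, ∫ x, L F x ∂ν = 0)
    {H : X → ℝ} (hH : H ∈ 𝒞) :
    ∫ x, H x ∂μ = ∫ x, H x ∂ν := by
  -- integrability of the bounded continuous members of `𝒞` and of their generator images
  have hint : ∀ F ∈ 𝒞, ∀ ρ : Measure X, IsFiniteMeasure ρ →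
      Integrable F ρ ∧ Integrable (L F) ρ := by
    intro F hF ρ hρ
    obtain ⟨hFc, hLFc, C, hC⟩ := hbdd F hF
    exact ⟨Integrable.of_bound hFc.aestronglyMeasurable C
        (Eventually.of_forall fun x => by simpa [Real.norm_eq_abs] using (hC x).1),
      Integrable.of_bound hLFc.aestronglyMeasurable C
        (Eventually.of_forall fun x => by simpa [Real.norm_eq_abs] using (hC x).2)⟩
  refine eq_of_forall_dist_le fun ε hε => ?_
  have hρK : ∀ᵐ x ∂(μ + ν), K x := (ae_add_measure_iff).2 ⟨hμK, hνK⟩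
  obtain ⟨F, hF, c, hFc⟩ := hsolv (μ + ν) inferInstance hρK H hH ε hε
  -- the residual `R = H - c - L F`
  set R : X → ℝ := fun x => H x - c - L F x with hR
  have hRint : ∀ ρ : Measure X, IsFiniteMeasure ρ → Integrable R ρ := by
    intro ρ hρ
    exact ((hint H hH ρ hρ).1.sub (integrable_const c)).sub (hint F hF ρ hρ).2
  -- `∫ H dρ = ∫ R dρ + c` for an annihilated probability law `ρ`
  have key : ∀ ρ : Measure X, IsProbabilityMeasure ρ → (∫ x, L F x ∂ρ = 0) →
      ∫ x, H x ∂ρ = ∫ x, R x ∂ρ + c := by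
    intro ρ hρ h0
    have h1 : ∫ x, R x ∂ρ = ∫ x, (H x - c) ∂ρ - ∫ x, L F x ∂ρ :=
      integral_sub ((hint H hH ρ inferInstance).1.sub (integrable_const c))
        (hint F hF ρ inferInstance).2
    have h2 : ∫ x, (H x - c) ∂ρ = ∫ x, H x ∂ρ - ∫ x, c ∂ρ :=
      integral_sub (hint H hH ρ inferInstance).1 (integrable_const c)
    rw [h1, h2, h0, integral_const, smul_eq_mul, probReal_univ, one_mul]
    ring
  rw [key μ inferInstance (hμL F hF), key ν inferInstance (hνL F hF), Real.dist_eq,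
    add_sub_add_right_eq_sub]
  calc |∫ x, R x ∂μ - ∫ x, R x ∂ν|
      ≤ |∫ x, R x ∂μ| + |∫ x, R x ∂ν| := abs_sub _ _
    _ ≤ ∫ x, |R x| ∂μ + ∫ x, |R x| ∂ν :=
        add_le_add abs_integral_le_integral_abs abs_integral_le_integral_abs
    _ = ∫ x, |R x| ∂(μ + ν) :=
        (integral_add_measure (hRint μ inferInstance).abs (hRint ν inferInstance).abs).symm
    _ ≤ ε := hFc

/-! ## Proved glue 2: the change of clock `δ^{-4}/⟨N⟩_δ ↦ δ^{-8/3}` -/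

/-- Singletons of the (discrete) space of lattice SAWs are measurable. [folklore] -/
instance instMeasurableSingletonClass_domainSAW {Ω : Set ℂ} {δ : ℝ} {u v : Site 2} :
    MeasurableSingletonClass (SAW.DomainSAW Ω δ u v) :=
  ⟨fun _ => MeasurableSpace.measurableSet_top⟩

/-- For a Dobrushin domain and a positive mesh there are only finitely many SAWs of `Ω_δ` between
two given sites (a self-avoiding walk of the finite graph `Ω_δ` has at most `|Ω_δ|` steps; same
argument as in `eventually_isProbabilityMeasure_law`). [folklore] -/
theorem finite_domainSAW (D : DobrushinDomain) {δ : ℝ} (hδ : 0 < δ) (u v : Site 2) :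
    Finite (SAW.DomainSAW D.carrier δ u v) := by
  have hfin : (meshDomain D.carrier δ).Finite := meshDomain_finite D.isBounded hδ
  -- every vertex of a walk of `Ω_δ` after the first lies in `Ω_δ`
  have hsupp : ∀ {u v : Site 2} (p : (discreteDomainGraph D.carrier δ).Walk u v),
      ∀ w ∈ p.support.tail, w ∈ meshDomain D.carrier δ := by
    intro u v p
    induction p with
    | nil => intro w hw; simp at hw
    | cons h q ih =>
      intro w hw
      rw [SimpleGraph.Walk.support_cons, List.tail_cons, SimpleGraph.Walk.mem_support_iff] at hw
      rcases hw with rfl | hw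
      · exact (discreteDomainGraph_adj_iff.1 h).2.2
      · exact ih w hw
  -- hence a self-avoiding walk of `Ω_δ` has at most `|Ω_δ|` steps
  have hlen : ∀ {u v : Site 2} (p : (discreteDomainGraph D.carrier δ).Walk u v),
      p.IsPath → p.length < hfin.toFinset.card + 1 := by
    intro u v p hp
    have hnd : p.support.tail.Nodup := List.Nodup.sublist (List.tail_sublist _) hp.support_nodup
    have h1 : p.support.tail.length = p.length := by
      rw [List.length_tail, SimpleGraph.Walk.length_support]
      rfl
    have h2 : p.support.tail.toFinset ⊆ hfin.toFinset := by
      intro w hw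
      rw [Set.Finite.mem_toFinset]
      exact hsupp p w (List.mem_toFinset.1 hw)
    have h3 := Finset.card_le_card h2
    rw [List.toFinset_card_of_nodup hnd, h1] at h3
    omega
  haveI : (discreteDomainGraph D.carrier δ).LocallyFinite :=
    fun v => (hfin.subset fun w hw =>
      (discreteDomainGraph_adj_iff.1 ((SimpleGraph.mem_neighborSet _ _ _).1 hw)).2.2).fintype
  refine Finite.of_injective
    (β := {p : (discreteDomainGraph D.carrier δ).Walk u v //
      p.IsPath ∧ p.length < hfin.toFinset.card + 1})
    (fun γ => ⟨γ.walk, γ.isPath, hlen γ.walk γ.isPath⟩) ?_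
  rintro ⟨p, hp⟩ ⟨q, hq⟩ h
  have hpq : p = q := congrArg Subtype.val h
  cases hpq
  rfl

/-- Pointwise-to-integral rescaling bound on a finite probability space: if `r·s = t` then
`∫ |t·X − ℓ·Y| ≤ |r|·∫ |s·X − Y| + |r − ℓ|·C` whenever `|Y| ≤ C`. [folklore] -/
theorem integral_rescale_le {Ω' : Type*} [MeasurableSpace Ω'] [Finite Ω']
    [MeasurableSingletonClass Ω'] (P : Measure Ω') [IsProbabilityMeasure P] (X Y : Ω' → ℝ)
    {C : ℝ} (hY : ∀ ω, |Y ω| ≤ C) (r s t ℓ : ℝ) (hrs : r * s = t) :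
    ∫ ω, |t * X ω - ℓ * Y ω| ∂P ≤ |r| * ∫ ω, |s * X ω - Y ω| ∂P + |r - ℓ| * C := by
  have hpt : ∀ ω, |t * X ω - ℓ * Y ω| ≤ |r| * |s * X ω - Y ω| + |r - ℓ| * C := by
    intro ω
    have h : t * X ω - ℓ * Y ω = r * (s * X ω - Y ω) + (r - ℓ) * Y ω := by
      rw [← hrs]; ring
    rw [h]
    calc |r * (s * X ω - Y ω) + (r - ℓ) * Y ω|
        ≤ |r * (s * X ω - Y ω)| + |(r - ℓ) * Y ω| := abs_add_le _ _
      _ = |r| * |s * X ω - Y ω| + |r - ℓ| * |Y ω| := by rw [abs_mul, abs_mul]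
      _ ≤ |r| * |s * X ω - Y ω| + |r - ℓ| * C :=
          add_le_add le_rfl (mul_le_mul_of_nonneg_left (hY ω) (abs_nonneg _))
  calc ∫ ω, |t * X ω - ℓ * Y ω| ∂P
      ≤ ∫ ω, (|r| * |s * X ω - Y ω| + |r - ℓ| * C) ∂P :=
        integral_mono Integrable.of_finite Integrable.of_finite hpt
    _ = |r| * ∫ ω, |s * X ω - Y ω| ∂P + |r - ℓ| * C := by
        rw [integral_add Integrable.of_finite Integrable.of_finite, integral_const_mul,
          integral_const, smul_eq_mul, probReal_univ, one_mul]

/-- **Change of clock.**  If the mean length satisfies `δ^{4/3}·⟨N⟩_δ → ℓ > 0` and the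
generator images `X δ` converge to `G ∘ curve` in `L¹(P_δ)` at the intrinsic speed
`δ^{-4}/⟨N⟩_δ`, then at the speed `δ^{-8/3}` they converge to `ℓ·G ∘ curve`
(`δ^{-8/3} = (δ^{4/3}⟨N⟩_δ)·(δ^{-4}/⟨N⟩_δ)`; the laws are eventually probability measures on
finite sets, so every function is integrable). [folklore] -/
theorem tendsto_rescale {D : DobrushinDomain} {a b : ℝ → Site 2} (hab : SAW.IsEndpointApprox D a b)
    (X : ∀ δ : ℝ, SAW.DomainSAW D.carrier δ (a δ) (b δ) → ℝ) (G : CurveClass ℂ → ℝ) {C : ℝ}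
    (hG : ∀ x, |G x| ≤ C) {ℓ : ℝ} (hℓ : 0 < ℓ)
    (hr : Tendsto (fun δ : ℝ => δ ^ ((4 : ℝ) / 3) *
      ∫ γ, (γ.length : ℝ) ∂(SAW.law D.carrier δ (a δ) (b δ))) (𝓝[>] (0 : ℝ)) (𝓝 ℓ))
    (hX : Tendsto (fun δ : ℝ => ∫ γ, |(δ ^ (-(4 : ℝ)) /
      ∫ γ', (γ'.length : ℝ) ∂(SAW.law D.carrier δ (a δ) (b δ))) * X δ γ - G γ.curve|
        ∂(SAW.law D.carrier δ (a δ) (b δ))) (𝓝[>] (0 : ℝ)) (𝓝 0)) :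
    Tendsto (fun δ : ℝ => ∫ γ, |δ ^ (-(8 : ℝ) / 3) * X δ γ - ℓ * G γ.curve|
      ∂(SAW.law D.carrier δ (a δ) (b δ))) (𝓝[>] (0 : ℝ)) (𝓝 0) := by
  have hne : ∀ᶠ δ in 𝓝[>] (0 : ℝ), δ ^ ((4 : ℝ) / 3) *
      ∫ γ, (γ.length : ℝ) ∂(SAW.law D.carrier δ (a δ) (b δ)) ≠ 0 := hr.eventually_ne hℓ.ne'
  have main : ∀ᶠ δ in 𝓝[>] (0 : ℝ),
      ∫ γ, |δ ^ (-(8 : ℝ) / 3) * X δ γ - ℓ * G γ.curve| ∂(SAW.law D.carrier δ (a δ) (b δ)) ≤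
        |δ ^ ((4 : ℝ) / 3) * ∫ γ, (γ.length : ℝ) ∂(SAW.law D.carrier δ (a δ) (b δ))| *
          ∫ γ, |(δ ^ (-(4 : ℝ)) / ∫ γ', (γ'.length : ℝ) ∂(SAW.law D.carrier δ (a δ) (b δ))) *
            X δ γ - G γ.curve| ∂(SAW.law D.carrier δ (a δ) (b δ)) +
        |δ ^ ((4 : ℝ) / 3) * ∫ γ, (γ.length : ℝ) ∂(SAW.law D.carrier δ (a δ) (b δ)) - ℓ| * C := by
    filter_upwards [eventually_isProbabilityMeasure_law hab, self_mem_nhdsWithin, hne] with δ hprob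
      hδpos hne'
    haveI := hprob
    haveI := finite_domainSAW D (show (0 : ℝ) < δ from hδpos) (a δ) (b δ)
    refine integral_rescale_le _ (X δ) (fun γ => G γ.curve) (fun γ => hG γ.curve) _ _ _ ℓ ?_
    have hδ : (0 : ℝ) < δ := hδpos
    have hN : ∫ γ, (γ.length : ℝ) ∂(SAW.law D.carrier δ (a δ) (b δ)) ≠ 0 := by
      intro h
      exact hne' (by rw [h, mul_zero])
    calc δ ^ ((4 : ℝ) / 3) * (∫ γ, (γ.length : ℝ) ∂(SAW.law D.carrier δ (a δ) (b δ))) *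
          (δ ^ (-(4 : ℝ)) / ∫ γ', (γ'.length : ℝ) ∂(SAW.law D.carrier δ (a δ) (b δ)))
        = δ ^ ((4 : ℝ) / 3) * δ ^ (-(4 : ℝ)) := by field_simp
      _ = δ ^ (-(8 : ℝ) / 3) := by rw [← Real.rpow_add hδ]; norm_num
  refine squeeze_zero' (Eventually.of_forall fun δ => integral_nonneg fun γ => abs_nonneg _)
    main ?_
  have h1 := hr.abs.mul hX
  have h2 := (hr.sub_const ℓ).abs.mul_const C
  simpa using h1.add h2

/-! ## The composition: the crux BY NAME from the three stubs -/

/-- **`DiffusiveSteinLimit` from (C), (N), (S).**  Given the intrinsic pair `(𝒞, L₁)` of (C) and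
the mean-length constant `ℓ = lim δ^{4/3}⟨N⟩_δ > 0` of (N), take the SAME core `𝒞` and
`L := ℓ • L₁`: generator convergence at speed `δ^{-8/3}` is the change of clock
(`tendsto_rescale`); the algebra, linearity and the second-order chain rule are homogeneous in
`L`; Stein uniqueness for `L₁` is the Stein step (`integral_eq_of_steinSolvable`, solvability
applied to `ρ = μ + ν`) followed by (S) (a point-separating multiplicative class of bounded
continuous functionals determines chord probability laws), and annihilation by `ℓ • L₁` is
annihilation by `L₁` since `ℓ ≠ 0`. -/
theorem DiffusiveSteinLimit_of (hC : Registered.stub_intrinsicSteinCore)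
    (hN : Registered.stub_meanLengthScaling) (hS : Registered.stub_separatingAlgebra) :
    Summit.CriticalPhenomena.SAWScalingLimit.Theses.SAWStochasticQuantisation.DiffusiveSteinLimit := by
  intro D a b hab
  obtain ⟨𝒞, L₁, hbdd, hmem, halg, hchain, hsep, hsolv⟩ := hC D a b hab
  obtain ⟨ℓ, hℓ, hr⟩ := hN D a b hab
  -- Stein uniqueness for the intrinsic pair `(𝒞, L₁)`: Stein step + separating class
  have huniq : ∀ μ ν : Measure (CurveClass ℂ), IsProbabilityMeasure μ → IsProbabilityMeasure ν →
      (∀ᵐ γ ∂μ, γ.source = D.pt 0 ∧ γ.target = D.pt 1 ∧ γ.range ⊆ closure D.carrier) →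
      (∀ᵐ γ ∂ν, γ.source = D.pt 0 ∧ γ.target = D.pt 1 ∧ γ.range ⊆ closure D.carrier) →
      (∀ F ∈ 𝒞, ∫ x, L₁ F x ∂μ = 0) → (∀ F ∈ 𝒞, ∫ x, L₁ F x ∂ν = 0) → μ = ν := by
    intro μ ν hμ hν hμc hνc hμL hνL
    refine hS D 𝒞 (fun F hF => ⟨(hbdd F hF).1, ?_⟩) (fun F hF G hG => (halg F hF G hG 0).2.1)
      hsep μ ν hμ hν hμc hνc fun H hH => ?_
    · obtain ⟨C, hC'⟩ := (hbdd F hF).2.2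
      exact ⟨C, fun x => (hC' x).1⟩
    · exact integral_eq_of_steinSolvable
        (K := fun γ : CurveClass ℂ =>
          γ.source = D.pt 0 ∧ γ.target = D.pt 1 ∧ γ.range ⊆ closure D.carrier)
        hbdd hsolv μ ν hμc hνc hμL hνL hH
  refine ⟨𝒞, fun F => ℓ • L₁ F, ?_, ?_, ?_, ?_, ?_⟩
  · -- bounded continuous
    intro F hF
    obtain ⟨hFc, hLc, C, hC'⟩ := hbdd F hF
    have hC0 : 0 ≤ C := (abs_nonneg _).trans (hC' (CurveClass.mk (Curve.const 0))).1
    refine ⟨hFc, hLc.const_smul ℓ, C + ℓ * C, fun x => ⟨?_, ?_⟩⟩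
    · exact (hC' x).1.trans (le_add_of_nonneg_right (mul_nonneg hℓ.le hC0))
    · show |ℓ • L₁ F x| ≤ C + ℓ * C
      rw [smul_eq_mul, abs_mul, abs_of_pos hℓ]
      exact (mul_le_mul_of_nonneg_left (hC' x).2 hℓ.le).trans (le_add_of_nonneg_left hC0)
  · -- generator convergence at speed δ^{-8/3}: the change of clock
    intro F hF
    obtain ⟨f, hf1, hf2⟩ := hmem F hF
    obtain ⟨-, -, C, hC'⟩ := hbdd F hF
    exact ⟨f, hf1, tendsto_rescale hab _ (L₁ F) (fun x => (hC' x).2) hℓ hr hf2⟩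
  · -- algebra and linearity
    intro F hF G hG c
    obtain ⟨h1, h2, h3, h4, h5⟩ := halg F hF G hG c
    refine ⟨h1, h2, h3, ?_, ?_⟩
    · show ℓ • L₁ (F + G) = ℓ • L₁ F + ℓ • L₁ G
      rw [h4, smul_add]
    · show ℓ • L₁ (c • F) = c • (ℓ • L₁ F)
      rw [h5, smul_comm]
  · -- second-order chain rule (homogeneous in `L`)
    intro F hF Φ hΦ
    obtain ⟨h1, h2⟩ := hchain F hF Φ hΦ
    refine ⟨h1, fun x => ?_⟩
    show ℓ • L₁ (Φ ∘ F) x = deriv Φ (F x) * (ℓ • L₁ F x) +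
      deriv^[2] Φ (F x) / 2 * (ℓ • L₁ ((fun t : ℝ => t ^ 2) ∘ F) x - 2 * F x * (ℓ • L₁ F x))
    simp only [smul_eq_mul]
    rw [h2 x]
    ring
  · -- Stein uniqueness: annihilation by `ℓ • L₁` is annihilation by `L₁`
    intro μ ν hμ hν hμc hνc hμL hνL
    refine huniq μ ν hμ hν hμc hνc (fun F hF => ?_) (fun F hF => ?_)
    · have h : ∫ x, ℓ * L₁ F x ∂μ = 0 := hμL F hF
      rw [integral_const_mul] at h
      exact (mul_eq_zero.1 h).resolve_left hℓ.ne'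
    · have h : ∫ x, ℓ * L₁ F x ∂ν = 0 := hνL F hF
      rw [integral_const_mul] at h
      exact (mul_eq_zero.1 h).resolve_left hℓ.ne'

/-- Wiring check: the crux BY NAME from the three registered (sorried) stubs — this declaration
inherits their `sorry`s and claims nothing; it shows the stub theorems are exactly the hypotheses
of `DiffusiveSteinLimit_of`. -/
theorem DiffusiveSteinLimit_wiring :
    Summit.CriticalPhenomena.SAWScalingLimit.Theses.SAWStochasticQuantisation.DiffusiveSteinLimit :=
  DiffusiveSteinLimit_of stub_intrinsicSteinCore stub_meanLengthScaling stub_separatingAlgebra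

end Summit.CriticalPhenomena.SAWScalingLimit.Cruxes.DiffusiveSteinLimit.Birth

end
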